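import Summits.BirchSwinnertonDyer.BirchSwinnertonDyer.Theorems.PrintCf2SplitBadTwoRestrictedSelmerTopOfConjFiniteness
import Summits.BirchSwinnertonDyer.BirchSwinnertonDyer.Theorems.PrintCf2SplitBadTwoRestrictedSelmerCokernelOfLocSurjFrame
import HarnessLib

/-!
# Crux `PrintCf2.SplitBadTwoRankOneOfFacts` (stmt-BirchSwinnertonDyer-20368), road α v10.3 — S3c residual (R-SURJ″) ASSEMBLED:
# cut 9's `hSurj` from the cited Poitou–Tate duality for Selmer structures, the conjugate relaxed finiteness hfinR′ and the local torsion bound hfix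

Cell `bsd-print-cf2`, width seat `bsd-line-cf2-p1-w5` g3 (prover-bsd-line-cf2-p1-w5-g3-0); lane «(R-SURJ)». `--supports stmt-BirchSwinnertonDyer-20368`
(helper, Theses-free). HONEST FRAMING: nothing here closes the crux or a registered stub; BSD is not proved by any of this; no summit statement is proved
by this seat. No definition, no named fact, no `sorry`. CONDITIONAL on the cited fact `poitouTate_selmerStructure_duality K` (Howard 2004 Thm. 2.1.11 /
Milne ADT I.4.10, the tree's named fact) and on the two displayed finiteness inputs hfinR′, hfix — the SAME inputs as -w4 g9's (R-TOP) assembly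
`natCard_endCoinvariants_eq_one_of_frame_of_conjFiniteness` (p673077), minus `poitouTate_sha_tateDual`, `fieldCdLE_two_of_numberField`, hfinB′.

WHAT.
* **`locSurj_of_frame_of_conjFiniteness`** — (LS) (the level-`K` local surjectivity for `W* = E[𝔮_r^∞]` at the strict place `v̄`, text of p668156) ON
  EVERY S3c FRAME (member `C • W = cm7^{(d)}`, `K` imaginary quadratic, `v ≠ v̄` over `2`, `π² = π − 2`, `r² = r − 2`), GRANTED hPTs, hfinR′, hfix:
  -w4 g9's `locSurj_of_proj` (p671851) with the CM projectors `e, e′` (-w7 g2 `exists_eigenProjector_two`), their sum `= id`, level cyclicity of the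
  summand (`exists_forall_levelProj_eq_zsmul`, p669287) and `j′ = ι′e′` (`exists_primaryEndo`) — the block -w4 g9 runs inline in p673077, exported.
* **`rSurj''_of_conjFiniteness`** — cut 7/8/9's displayed (R-SURJ″) (`hSurj` of `restrictedControl_two_of_top_surj_bv`, p671311; byte-identical to
  p668543's) with `e_s ≡ −1`, from `hPTs : ∀ K, poitouTate_selmerStructure_duality K`, `hfinR′` and `hfix` quantified over the frames — via file 4b's
  `rSurj''_of_locSurj` (p670812).
So after this file and p673077 BOTH Poitou–Tate residuals of cut 9 rest on: three cited facts, hfinB′ (a theorem from hfinB by -w2 g10's transport),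
hfinR′ (hfinB′ relaxed on a finite `R` away from `2` — port of X11b `Coinv.finite_relaxed` to `W*′`, FREE), hfix (finite local torsion at `v`, FREE).
presearch: not applicable (assembly). beyond-print theorem: no.

References: [JetchevSkinnerWan2017] Lemma 3.3.3, Prop. 3.3.2; [Howard2004HeegnerKolyvagin] Thm. 2.1.11; [Agboola2007] §3 Prop. 3.2, §6;
[GreenbergLNM1716] §3 Lemmas 3.1–3.3.
-/

noncomputable section

open scoped Classical

set_option linter.dupNamespace false
set_option autoImplicit false

open CategoryTheory NumberField IsDedekindDomain Field WeierstrassCurve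
open Literature.NumberTheory.EllipticCurves Literature.NumberTheory.EllipticCurves.GreenbergSelmer
open Literature.NumberTheory.EllipticCurves.Agboola2007
open Literature.NumberTheory.EllipticCurves.IwasawaAlgebra
open Literature.NumberTheory.EllipticCurves.IwasawaDual
open Literature.NumberTheory.GaloisRepresentations
open Literature.NumberTheory.GaloisCohomology
open scoped ContRepresentation
open Summit.BirchSwinnertonDyer.Rank1Residual.X11b
open Summit.BirchSwinnertonDyer.Rank1Residual.X11b.LocBridge
open Summit.BirchSwinnertonDyer.Rank1Residual.X11b.AcSelmer
open Summit.BirchSwinnertonDyer.BirchSwinnertonDyer.Theorems.PrintCf2.AdditiveAtSeven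
open Summit.BirchSwinnertonDyer.BirchSwinnertonDyer.Theorems.PrintCf2.LevelEigen
open Summit.BirchSwinnertonDyer.BirchSwinnertonDyer.Theorems.GoldfeldGoodTwists

namespace Summit.BirchSwinnertonDyer.BirchSwinnertonDyer.Theorems.PrintCf2.RestrictedSelmerPair

variable {K : Type} [Field K] [NumberField K]

/-- **(LS) ON EVERY S3c FRAME from hPTs, hfinR′, hfix** (-w4 g9's `locSurj_of_proj`, p671851, instantiated with the CM projectors — the inline block of
p673077 exported): every finitely supported family of local classes of `W*` at places away from `2` or at `v̄` is the family of local restrictions of a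
global class vanishing at the other places away from `2`. [cite: JetchevSkinnerWan2017, Prop. 3.3.2] [cite: Howard2004HeegnerKolyvagin, Thm. 2.1.11] -/
theorem locSurj_of_frame_of_conjFiniteness {d : ℤ} (hd0 : d ≠ 0) (W : WeierstrassCurve ℚ) [W.IsElliptic]
    (C : VariableChange ℚ) (hC : C • W = cm7.quadraticTwist (d : ℚ)) (hK : IsImaginaryQuadratic K)
    {v vbar : HeightOneSpectrum (𝓞 K)} (hv : ((2 : ℕ) : 𝓞 K) ∈ v.asIdeal) (hvbar : ((2 : ℕ) : 𝓞 K) ∈ vbar.asIdeal) (hne : vbar ≠ v)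
    (π : (W.baseChange K).endRing) (hrel : (π : AddMonoid.End (W.baseChange K).geomPoints) * π = π - 2) {r : ℤ_[2]} (hr : r * r = r - 2)
    (hPTs : poitouTate_selmerStructure_duality K)
    (hfinR' : ∀ (e' : (W.baseChange K).geomPrimaryTorsion 2 →+ ↥((W.baseChange K).endEigenPrimaryTorsion 2 π (1 - r)))
      (j' : (primaryGaloisModule (W.baseChange K) 2).toContRepresentation →ⁱL (primaryGaloisModule (W.baseChange K) 2).toContRepresentation),
      (∀ x, j' x = (e' x : (W.baseChange K).geomPrimaryTorsion 2)) →
      ∀ R : Set (HeightOneSpectrum (𝓞 K)), R.Finite → (∀ w ∈ R, ((2 : ℕ) : 𝓞 K) ∉ w.asIdeal) →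
        Finite (((acStructure (primaryGaloisModule (W.baseChange K) 2) 2 v R).selmerGroup).map (galoisCohomology.map j' 1)))
    (hfix : ∃ m : ℕ, ∀ Q : (W.baseChange K).geomPrimaryTorsion 2,
      (∀ σ : absoluteGaloisGroup (v.adicCompletion K),
        GaloisRep.restrictField (v.adicCompletion K) (primaryGaloisModule (W.baseChange K) 2) σ Q = Q) → 2 ^ m • Q = 0) :
    ∀ (S : Finset (HeightOneSpectrum (𝓞 K))), (∀ w ∈ S, ((2 : ℕ) : 𝓞 K) ∉ w.asIdeal ∨ w = vbar) →
      ∀ τ : (w : HeightOneSpectrum (𝓞 K)) → subgroupH1 (decomp (K := K) w) ↥((W.baseChange K).endEigenPrimaryTorsion 2 π r),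
      ∃ g : discreteH1 (absoluteGaloisGroup K) ↥((W.baseChange K).endEigenPrimaryTorsion 2 π r),
        (∀ w ∈ S, ResKernel.resSubgroup (decomp (K := K) w) ↥((W.baseChange K).endEigenPrimaryTorsion 2 π r) g = τ w) ∧
        (∀ w : HeightOneSpectrum (𝓞 K), w ∉ S → ((2 : ℕ) : 𝓞 K) ∉ w.asIdeal →
          ResKernel.resSubgroup (decomp (K := K) w) ↥((W.baseChange K).endEigenPrimaryTorsion 2 π r) g = 0) := by
  haveI : Fact (Nat.Prime 2) := ⟨Nat.prime_two⟩
  haveI : (W.baseChange K).IsElliptic := by rw [baseChange]; infer_instance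
  haveI : IsTotallyComplex K := hK.2
  have hj : W.j = -3375 := j_eq_of_smul_eq_cm7Twist hd0 W C hC
  obtain ⟨θ, hθ⟩ := exists_sq_eq_neg_seven_of_cmEndo_mem_endRing W K hj π hrel
  have hr' : (1 - r) * (1 - r) = (1 - r) - 2 := by linear_combination hr
  obtain ⟨e, he₁, he₂, hesub, he⟩ := exists_eigenProjector_two W hj K hθ π hrel hr
  obtain ⟨e', he₁', he₂', -, he'⟩ := exists_eigenProjector_two W hj K hθ π hrel hr'
  rw [sub_sub_cancel] at he₂'
  have hsum : ∀ x, (e x : (W.baseChange K).geomPrimaryTorsion 2) + (e' x : (W.baseChange K).geomPrimaryTorsion 2) = x := by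
    intro x
    have h1 : ((e' (x - (e x : (W.baseChange K).geomPrimaryTorsion 2)) : (W.baseChange K).geomPrimaryTorsion 2)) =
        x - (e x : (W.baseChange K).geomPrimaryTorsion 2) := by
      have := he₁' ⟨x - (e x : (W.baseChange K).geomPrimaryTorsion 2), hesub x⟩
      exact congrArg Subtype.val this
    have h2 : e' (e x : (W.baseChange K).geomPrimaryTorsion 2) = 0 := he₂' _ (e x).2
    have h3 : e' x = e' (x - (e x : (W.baseChange K).geomPrimaryTorsion 2)) + e' (e x : (W.baseChange K).geomPrimaryTorsion 2) := by
      rw [← map_add, sub_add_cancel]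
    rw [h3, h2, add_zero, h1, add_sub_cancel]
  -- level cyclicity of `W*` and the endomorphism `j' = ι' e'`
  have hcyc : ∀ (N : ℕ) (eN : ((W.baseChange K).torsionGaloisModule ((2 ^ N : ℕ) : ℤ)).toContRepresentation →ⁱL
      ((W.baseChange K).torsionGaloisModule ((2 ^ N : ℕ) : ℤ)).toContRepresentation),
      (∀ x, Levels.primaryInclusion (W.baseChange K) 2 N (eN x) ∈ (W.baseChange K).endEigenPrimaryTorsion 2 π r) →
        ∃ g : (W.baseChange K).geomTorsion ((2 ^ N : ℕ) : ℤ), ∀ x, ∃ a : ℤ, eN x = a • g :=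
    fun N eN heN ↦ exists_forall_levelProj_eq_zsmul W hj K hθ π hrel hr N eN heN
  have hjf' : ∀ (σ : absoluteGaloisGroup K) (x : (W.baseChange K).geomPrimaryTorsion 2),
      (((W.baseChange K).endEigenPrimaryTorsion 2 π (1 - r)).subtype.comp e') (σ • x) =
        σ • (((W.baseChange K).endEigenPrimaryTorsion 2 π (1 - r)).subtype.comp e') x := fun σ x ↦ by
    simp only [AddMonoidHom.comp_apply, AddSubgroup.coe_subtype, he', WeierstrassCurve.endEigenPrimaryTorsion.coe_smul]
  obtain ⟨j', hj'⟩ := exists_primaryEndo (W.baseChange K) 2 (((W.baseChange K).endEigenPrimaryTorsion 2 π (1 - r)).subtype.comp e') hjf'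
  have hj'' : ∀ x, j' x = (e' x : (W.baseChange K).geomPrimaryTorsion 2) := fun x ↦ hj' x
  intro S hS τ
  exact locSurj_of_proj (W.baseChange K) 2 π r (1 - r) vbar hPTs e e' he₁ he he₁' he' hsum hcyc j' hj'' hvbar hv hne.symm
    (hfinR' e' j' hj'') hfix S hS τ

/-- **CUT 7/8/9's (R-SURJ″) (`hSurj` of `restrictedControl_two_of_top_surj_bv`, p671311) VERBATIM, `e_s ≡ −1`, FROM hPTs + hfinR′ + hfix** — the
same displayed inputs as the (R-TOP) assembly p673077 (minus `poitouTate_sha_tateDual`, `fieldCdLE_two_of_numberField`, hfinB′): (LS) per frame by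
`locSurj_of_frame_of_conjFiniteness`, then file 4b's `rSurj''_of_locSurj` (exact cokernel `relIndex · 2 = ∏ #LK_w · #LK_{v̄}`, δ = 1).
[cite: Agboola2007, §3 Prop. 3.2, §6] [cite: GreenbergLNM1716, §3 Lemmas 3.1–3.3] [cite: JetchevSkinnerWan2017, Lemma 3.3.3, Prop. 3.3.2] -/
theorem rSurj''_of_conjFiniteness
    (hPTs : ∀ (K : Type) [Field K] [NumberField K], poitouTate_selmerStructure_duality K)
    (hfinR'all : ∀ (d : ℤ), d ≠ 0 → Squarefree d → d % 4 ≠ 1 →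
      ∀ (W : WeierstrassCurve ℚ) [W.IsElliptic] (C : VariableChange ℚ), C • W = cm7.quadraticTwist (d : ℚ) →
      ∀ (K : Type) [Field K] [NumberField K], IsImaginaryQuadratic K →
      ∀ (v vbar : HeightOneSpectrum (𝓞 K)),
        ((2 : ℕ) : 𝓞 K) ∈ v.asIdeal → ((2 : ℕ) : 𝓞 K) ∈ vbar.asIdeal → vbar ≠ v →
      ∀ (π : (W.baseChange K).endRing), (π : AddMonoid.End (W.baseChange K).geomPoints) * π = π - 2 →
      ∀ (r : ℤ_[2]), r * r = r - 2 →
      ∀ (e' : (W.baseChange K).geomPrimaryTorsion 2 →+ ↥((W.baseChange K).endEigenPrimaryTorsion 2 π (1 - r)))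
      (j' : (primaryGaloisModule (W.baseChange K) 2).toContRepresentation →ⁱL (primaryGaloisModule (W.baseChange K) 2).toContRepresentation),
      (∀ x, j' x = (e' x : (W.baseChange K).geomPrimaryTorsion 2)) →
      ∀ R : Set (HeightOneSpectrum (𝓞 K)), R.Finite → (∀ w ∈ R, ((2 : ℕ) : 𝓞 K) ∉ w.asIdeal) →
        Finite (((acStructure (primaryGaloisModule (W.baseChange K) 2) 2 v R).selmerGroup).map (galoisCohomology.map j' 1)))
    (hfixall : ∀ (d : ℤ), d ≠ 0 → Squarefree d → d % 4 ≠ 1 →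
      ∀ (W : WeierstrassCurve ℚ) [W.IsElliptic] (C : VariableChange ℚ), C • W = cm7.quadraticTwist (d : ℚ) →
      ∀ (K : Type) [Field K] [NumberField K], IsImaginaryQuadratic K →
      ∀ (v vbar : HeightOneSpectrum (𝓞 K)),
        ((2 : ℕ) : 𝓞 K) ∈ v.asIdeal → ((2 : ℕ) : 𝓞 K) ∈ vbar.asIdeal → vbar ≠ v →
      ∀ (π : (W.baseChange K).endRing), (π : AddMonoid.End (W.baseChange K).geomPoints) * π = π - 2 →
      ∀ (r : ℤ_[2]), r * r = r - 2 →
      ∃ m : ℕ, ∀ Q : (W.baseChange K).geomPrimaryTorsion 2,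
      (∀ σ : absoluteGaloisGroup (v.adicCompletion K),
        GaloisRep.restrictField (v.adicCompletion K) (primaryGaloisModule (W.baseChange K) 2) σ Q = Q) → 2 ^ m • Q = 0) :
    ∃ es : ℤ → ℤ → ℤ, ∀ (d : ℤ), d ≠ 0 → Squarefree d → d % 4 ≠ 1 →
      ∀ (W : WeierstrassCurve ℚ) [W.IsElliptic] [W.IsGloballyMinimal] (C : VariableChange ℚ),
        C • W = cm7.quadraticTwist (d : ℚ) → W.analyticRank = 1 →
      ∀ (K : Type) [Field K] [NumberField K], IsImaginaryQuadratic K →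
      ∀ (v vbar : HeightOneSpectrum (𝓞 K)),
        ((2 : ℕ) : 𝓞 K) ∈ v.asIdeal → ((2 : ℕ) : 𝓞 K) ∈ vbar.asIdeal → vbar ≠ v →
      ∀ (π : (W.baseChange K).endRing), (π : AddMonoid.End (W.baseChange K).geomPoints) * π = π - 2 →
      ∀ (r : ℤ_[2]), r * r = r - 2 →
        (∀ τ ∈ GreenbergSelmer.inertia v, ∀ x : ↥((W.baseChange K).endEigenPrimaryTorsion 2 π r), τ • x = x ∨ τ • x = -x) →
      ∀ (κ' : ZpExtension K 2), κ'.IsUnramifiedOutside vbar → ∀ (γ' : absoluteGaloisGroup K), κ'.IsTopGenerator γ' →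
      Finite (endInvariants (conjRestricted κ' ↥((W.baseChange K).endEigenPrimaryTorsion 2 π r) vbar γ' - 1)) →
      ∀ (T : Finset (HeightOneSpectrum (𝓞 K))),
        (∀ w : HeightOneSpectrum (𝓞 K), w ∈ T ↔ ((2 : ℕ) : 𝓞 K) ∉ w.asIdeal ∧ ((7 * d : ℤ) : 𝓞 K) ∈ w.asIdeal) →
        (padicValNat 2 ((((restrictedSelmerBase ↥((W.baseChange K).endEigenPrimaryTorsion 2 π r) 2 vbar).map
            (resOfLe ↥((W.baseChange K).endEigenPrimaryTorsion 2 π r) (le_top : κ'.kerSubgroup ≤ ⊤))).addSubgroupOf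
            (restrictedSelmerZp κ' ↥((W.baseChange K).endEigenPrimaryTorsion 2 π r) vbar)).relIndex
          (endInvariants (conjRestricted κ' ↥((W.baseChange K).endEigenPrimaryTorsion 2 π r) vbar γ' - 1))) : ℤ) =
        (∑ w ∈ T, padicValNat 2 (Nat.card (resOfLe ↥((W.baseChange K).endEigenPrimaryTorsion 2 π r) (inf_le_inf_right (decomp w) (le_top : κ'.kerSubgroup ≤ ⊤))).ker) : ℕ) +
          padicValNat 2 (Nat.card (resOfLe ↥((W.baseChange K).endEigenPrimaryTorsion 2 π r) (inf_le_inf_right (decomp vbar) (le_top : κ'.kerSubgroup ≤ ⊤))).ker) +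
          es (d % 2) ((d / (2 - d % 2)) % 8) :=
  rSurj''_of_locSurj fun d hd0 hsq hd4 W _ C hC K _ _ hK v vbar hv hvbar hne π hrel r hr ↦
    locSurj_of_frame_of_conjFiniteness hd0 W C hC hK hv hvbar hne π hrel hr (hPTs K)
      (hfinR'all d hd0 hsq hd4 W C hC K hK v vbar hv hvbar hne π hrel r hr)
      (hfixall d hd0 hsq hd4 W C hC K hK v vbar hv hvbar hne π hrel r hr)

end Summit.BirchSwinnertonDyer.BirchSwinnertonDyer.Theorems.PrintCf2.RestrictedSelmerPair

end
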